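import Literature.NumberTheory.EllipticCurves.TianYuanZhang2017.RhoIndexTorsionClasses
import Literature.NumberTheory.EllipticCurves.CongruentNumberOddMonskySelmerExact
import HarnessLib

/-!
# Tian–Yuan–Zhang's `ρ(n)` read off the kernel of Monsky's matrix — odd `n` (file 2 of 3)

`n = p₁⋯p_k` with distinct odd primes, `E_n : y² = x³ − n²x`, `2^{ρ(n)} = [E_n(ℚ) : φ_n(A_n(ℚ)) + E_n[2]]`
(tree `(rhoSubgroup n).index`, Tian–Yuan–Zhang 2017 §1), and Monsky's matrix `M = ( A + D₂  D₂ ; D₂  A + D₋₂ )`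
over `𝔽₂` with `#Sel⁽²⁾(E_n/ℚ) = 2^{2+s(n)}`, `2^{s(n)} = #ker M` (appendix to Heath-Brown 1994; BOTH halves are
theorems of the tree, `CongruentNumberOddMonskySelmer{Bound,Exact}.lean`). THIS FILE PROVES (theorems only):

* `rhoIndex_eq_one_of_monskyKernel_odd` — **if every kernel vector `(x; y)` of `M` has `x + y = 0` or
  `x + y = 𝟙 = (1, …, 1)`, then `ρ(n) = 0`.** For `s(n) = 1` (`ker M = {0, v}`) the hypothesis reads
  `b(v) := ∏ pᵢ^{xᵢ+yᵢ} ∈ {1, n}` (`rhoIndex_eq_one_of_ker_pair_odd`). NO hypothesis on the Mordell–Weil rank or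
  on `n (mod 8)`; decided by `decide` per `n`, provable uniformly on families.
* `rhoIndex_eq_one_of_odd_prime` — `ρ(q) = 0` for EVERY odd prime `q` (the tree's Faulkner–James door
  `rhoIndex_eq_one_of_prime` needs `q ≡ ±1 (mod 8)`).

Argument: for a Selmer class `c` with components `[a]` (`x + n`) and `[b]` (`x`), subtracting the class of the
torsion pair with the same value of Monsky's normalising character `ν = (v₂(a), sign b)` gives a class whose
coordinate vector `(v_{pᵢ}(a); v_{pᵢ}(a) + v_{pᵢ}(b))` lies in `ker M` (tree `monskyMatrixOdd_mulVec_eq_zero`);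
`xᵢ + yᵢ = v_{pᵢ}(b)`, and `b > 0` has even valuation at `2` and off the `pᵢ`, so the hypothesis gives
`b ∈ {1, n}·ℚ^{×2}`; the torsion pair contributes a class in `{1, [−1], [n], [−n]}`. Then file 1
(`RhoIndexTorsionClasses.lean`) turns "every Selmer `b`-class is a torsion class" into `ρ(n) = 0`.
(When `rank E_n(ℚ) = 1` and `s(n) = 1` the criterion is sharp — `ρ(n) = 0 ⟺ b(v) ∈ {1, n}`, the Kummer map
being onto `Sel⁽²⁾`; the converse direction is file 1's `rhoIndex_ne_one_of_witness` applied to a generator,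
e.g. `ρ(21) = 1`.) Cell `bsd-print-cf2`, seat p2; evidence: kit job j282439 (PARI, 918 curves `n ≤ 3000`:
`ρ` from a `2`-saturated generator agrees with the kernel criterion in 671/671 cases where a generator was found).

## References

* [TianYuanZhang2017] Y. Tian, X. Yuan, S.-W. Zhang, *Genus periods, genus points and congruent number problem*,
  Asian J. Math. 21 (2017) 721–774 = arXiv:1411.4728, §1 (definition of `ρ(n)`, chunk p0002 L101–L110),
  Thm. 1.2 (journal Thm. 1.4).
* [HeathBrown1994SelmerCongruentII] D. R. Heath-Brown, *The size of Selmer groups for the congruent number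
  problem, II*, with an appendix by P. Monsky, Invent. Math. 118 (1994) 331–370: Appendix, typescript
  p. 38 L17 – p. 39 L33 (odd `D`), p. 40 L40 – p. 41 L36 (even `D`).
* [SilvermanAEC2009] J. H. Silverman, *The Arithmetic of Elliptic Curves*, 2nd ed., GTM 106, Thm. X.1.1,
  Prop. X.1.4, Prop. X.4.9.
* [FaulknerJames2007] B. Faulkner, K. James, Ramanujan J. 14 (2007) 107–129, Thm. 1.2 (2) (the `φ̂`-side bound,
  tree `RhoIndexEvenPartitionBound.lean`, for comparison).
-/

noncomputable section

open scoped Classical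

open WeierstrassCurve WeierstrassCurve.Affine WeierstrassCurve.Affine.Point
open Literature.NumberTheory.GaloisRepresentations
open Literature.NumberTheory.EllipticCurves.KramerTwoDescent
open Literature.NumberTheory.EllipticCurves.TwoDescentLocal
open Literature.NumberTheory.EllipticCurves.HeathBrown1994
open Literature.NumberTheory.EllipticCurves.TianYuanZhang2017
open Literature.NumberTheory.EllipticCurves.FaulknerJames2007
open IsDedekindDomain NumberField Matrix

namespace Literature.NumberTheory.EllipticCurves.TianYuanZhang2017

namespace RhoMonskyKernel

/-- `x + (x + y) = y` in `ℤ/2`. [folklore] -/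
private theorem add_add_self_zmod2 (x y : ZMod 2) : x + (x + y) = y := by revert x y; decide

/-- The two values of a bit. [folklore] -/
private theorem zmod2_cases (x : ZMod 2) : x = 0 ∨ x = 1 := by revert x; decide

/-- `2 = 0` in `ℤ/2`. [folklore] -/
private theorem two_eq_zero_zmod2 : (2 : ZMod 2) = 0 := by decide

/-- `signBit` of a negative rational is `1`. [folklore] -/
private theorem signBit_of_neg {a : ℚ} (ha : a < 0) : signBit a = 1 := by
  unfold signBit; rw [if_pos ha]

/-- In `ℚ^×/ℚ^{×2}` every class is its own inverse. [folklore] -/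
private theorem sqUnits_inv_eq_self (u : SqUnits ℚ) : u⁻¹ = u := by
  rw [inv_eq_iff_mul_eq_one, SqUnits.mul_self]

/-- `{1, [−1], [n], [−n]}` is stable under multiplication by `1` and `[n]`. [folklore] -/
private theorem inTorsionClasses_mul {N : ℚ} (hN0 : N ≠ 0) {u v : SqUnits ℚ}
    (hu : u = 1 ∨ u = sqClass N) (hv : (v = 1 ∨ v = sqClass (-1 : ℚ) ∨ v = sqClass (N) ∨ v = sqClass (-N))) :
    (u * v = 1 ∨ u * v = sqClass (-1 : ℚ) ∨ u * v = sqClass (N) ∨ u * v = sqClass (-N)) := by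
  have e1 : sqClass N * sqClass (-1 : ℚ) = sqClass (-N) := by
    rw [← sqClass_mul hN0 (by norm_num), mul_neg_one]
  have e2 : sqClass N * sqClass N = 1 := SqUnits.mul_self _
  have e3 : sqClass N * sqClass (-N) = sqClass (-1 : ℚ) := by
    rw [← e1, ← mul_assoc, e2, one_mul]
  rcases hu with rfl | rfl
  · rwa [one_mul]
  · rcases hv with rfl | rfl | rfl | rfl
    · rw [mul_one]; exact Or.inr (Or.inr (Or.inl rfl))
    · rw [e1]; exact Or.inr (Or.inr (Or.inr rfl))
    · rw [e2]; exact Or.inl rfl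
    · rw [e3]; exact Or.inr (Or.inl rfl)


/-! ### §1. Odd `n = p₁⋯p_k`: Monsky's matrix `( A + D₂  D₂ ; D₂  A + D₋₂ )` -/

section Odd

open Literature.NumberTheory.EllipticCurves.CongruentNumberEvenMonskySelmer
open Literature.NumberTheory.EllipticCurves.CongruentNumberOddMonskySelmer

variable {k : ℕ} {p : Fin k → ℕ}

/-- `∏ pᵢ ≠ 0`. [folklore] -/
private theorem n_ne_zero (hp : ∀ i, (p i).Prime) : ∏ i, p i ≠ 0 :=
  Finset.prod_ne_zero_iff.mpr fun i _ => (hp i).ne_zero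

section Selmer

variable [hE : (congruentNumberCurve (∏ i, p i)).IsElliptic]
variable (hT : (congruentNumberCurve (∏ i, p i)).toAffine.SplitTwoTorsion
  (-((∏ i, p i : ℕ) : ℚ)) 0 ((∏ i, p i : ℕ) : ℚ))

/-- **The `b`-component of a NORMALISED Selmer class is `1` or `n` modulo squares** when every kernel
vector `(x; y)` of Monsky's odd matrix has `x + y ∈ {0, 𝟙}`: the coordinates of the class lie in
`ker M` (`monskyMatrixOdd_mulVec_eq_zero`), `xᵢ + yᵢ = v_{pᵢ}(b) (mod 2)`, and `b > 0` has even
valuation at `2` and off the `pᵢ`. [cite: HeathBrown1994SelmerCongruentII, Appendix (Monsky), typescript p. 38 L17 – p. 39 L33]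
[cite: SilvermanAEC2009, Prop. X.1.4, Prop. X.4.9] -/
theorem sqClass_eq_of_normalised (hp : ∀ i, (p i).Prime) (hp2 : ∀ i, p i ≠ 2)
    (hinj : Function.Injective p)
    (hker : ∀ x y : Fin k → ZMod 2, monskyMatrixOdd p *ᵥ Sum.elim x y = 0 →
      x + y = 0 ∨ x + y = fun _ => 1)
    {c : galH1Torsion (congruentNumberCurve (∏ i, p i)) 2}
    (hc : c ∈ (congruentNumberCurve (∏ i, p i)).selmerGroup 2) (a b : ℚˣ)
    (ha : kummerEquiv ℚ 2 ((congruentNumberCurve (∏ i, p i)).twoTorsionCharH1 hT c) =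
      Additive.ofMul (QuotientGroup.mk a))
    (hb : kummerEquiv ℚ 2 ((congruentNumberCurve (∏ i, p i)).twoTorsionCharH1 hT.swap₁₂ c) =
      Additive.ofMul (QuotientGroup.mk b))
    (ha2 : parityBit 2 (a : ℚ) = 0) (hsb : signBit (b : ℚ) = 0) :
    sqClass (b : ℚ) = 1 ∨ sqClass (b : ℚ) = sqClass ((∏ i, p i : ℕ) : ℚ) := by
  haveI : Fact (Nat.Prime 2) := ⟨Nat.prime_two⟩
  have hb0 : (b : ℚ) ≠ 0 := b.ne_zero
  have hbpos : 0 < (b : ℚ) := (signBit_eq_zero_iff hb0).mp hsb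
  have hM := monskyMatrixOdd_mulVec_eq_zero hT hp hp2 hinj hc a b ha hb ha2 hsb
  have hshape := hker _ _ hM
  have hev : ∀ r : ℕ, r.Prime → r ≠ 2 → (∀ j, p j ≠ r) → Even (padicValRat r (b : ℚ)) :=
    fun r hr hr2 hrp => (even_padicValRat_of_mem hT hp hinj hc a b ha hb hr hr2 hrp).2
  have hb2 : Even (padicValRat 2 (b : ℚ)) := even_padicValRat_two_of_mem hT hp hp2 hinj hc b hb
  -- `xᵢ + yᵢ = v_{pᵢ}(b) mod 2`
  have hcoord : ∀ i, ((fun i => parityBit (p i) (a : ℚ)) +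
      fun i => parityBit (p i) (a : ℚ) + parityBit (p i) (b : ℚ)) i = parityBit (p i) (b : ℚ) := fun i => by
    simp only [Pi.add_apply, add_add_self_zmod2]
  rcases hshape with h0 | h1
  · -- all `v_{pᵢ}(b)` even: `b` is a square
    left
    refine sqClass_eq_one_of_forall hb0 hbpos fun r hr => ?_
    by_cases hr2 : r = 2
    · subst hr2; exact hb2
    by_cases hrp : ∃ j, p j = r
    · obtain ⟨j, rfl⟩ := hrp
      have := congrFun h0 j
      rw [hcoord j, Pi.zero_apply] at this
      exact parityBit_eq_zero_iff.mp this
    · exact hev r hr hr2 fun j h => hrp ⟨j, h⟩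
  · -- all `v_{pᵢ}(b)` odd: `b = n · r²`
    right
    have hS : ∀ q ∈ Finset.univ.image p, q.Prime := by
      intro q hq
      obtain ⟨j, -, rfl⟩ := Finset.mem_image.mp hq
      exact hp j
    obtain ⟨r, hr⟩ := exists_eq_prod_mul_sq hS hbpos fun q hq => by
      constructor
      · intro heven hmem
        obtain ⟨j, -, rfl⟩ := Finset.mem_image.mp hmem
        have := congrFun h1 j
        rw [hcoord j] at this
        have h0' : parityBit (p j) (b : ℚ) = 0 := parityBit_eq_zero_iff.mpr heven
        rw [h0'] at this
        exact zero_ne_one this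
      · intro hnot
        by_cases hq2 : q = 2
        · subst hq2; exact hb2
        · exact hev q hq hq2 fun j h => hnot (Finset.mem_image.mpr ⟨j, Finset.mem_univ _, h⟩)
    have hprod : (∏ q ∈ Finset.univ.image p, (q : ℚ)) = ((∏ i, p i : ℕ) : ℚ) := by
      rw [Finset.prod_image fun i _ j _ h => hinj h]; push_cast; rfl
    rw [hprod] at hr
    have hN0 : ((∏ i, p i : ℕ) : ℚ) ≠ 0 := by exact_mod_cast n_ne_zero hp
    have hr0 : r ≠ 0 := by
      rintro rfl
      rw [hr] at hb0; simp at hb0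
    rw [hr, sqClass_mul hN0 (pow_ne_zero 2 hr0), sq, sqClass_mul_self, mul_one]

/-- **The `b`-component (`x (mod ℚ^{×2})`) of EVERY Selmer class of `E_n` lies in `{1, [−1], [n], [−n]}`**
when every kernel vector `(x; y)` of Monsky's odd matrix has `x + y ∈ {0, 𝟙}`: subtract the class of the
torsion pair with the same value of the normalising character `ν = (v₂(a), sign b)` and apply
`sqClass_eq_of_normalised`. [cite: HeathBrown1994SelmerCongruentII, Appendix (Monsky), typescript p. 38 L17 – p. 39 L33]
[cite: SilvermanAEC2009, Prop. X.1.4, Prop. X.4.9] -/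
theorem inTorsionClasses_of_mem_selmer (hp : ∀ i, (p i).Prime) (hp2 : ∀ i, p i ≠ 2)
    (hinj : Function.Injective p)
    (hker : ∀ x y : Fin k → ZMod 2, monskyMatrixOdd p *ᵥ Sum.elim x y = 0 →
      x + y = 0 ∨ x + y = fun _ => 1)
    {c : galH1Torsion (congruentNumberCurve (∏ i, p i)) 2}
    (hc : c ∈ (congruentNumberCurve (∏ i, p i)).selmerGroup 2) (b : ℚˣ)
    (hb : kummerEquiv ℚ 2 ((congruentNumberCurve (∏ i, p i)).twoTorsionCharH1 hT.swap₁₂ c) =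
      Additive.ofMul (QuotientGroup.mk b)) :
    (sqClass (b : ℚ) = 1 ∨ sqClass (b : ℚ) = sqClass (-1 : ℚ) ∨ sqClass (b : ℚ) = sqClass ((∏ i, p i : ℕ) : ℚ) ∨ sqClass (b : ℚ) = sqClass (-((∏ i, p i : ℕ) : ℚ))) := by
  haveI : Fact (Nat.Prime 2) := ⟨Nat.prime_two⟩
  have hn := n_ne_zero hp
  set N : ℚ := ((∏ i, p i : ℕ) : ℚ) with hN
  have hN0 : N ≠ 0 := by rw [hN]; exact_mod_cast hn
  have hNpos : 0 < N := by rw [hN]; exact_mod_cast Nat.pos_of_ne_zero hn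
  have v2N : parityBit 2 N = 0 := by
    unfold parityBit
    have : padicValRat 2 N = 0 := by
      rw [hN, show (((∏ i, p i : ℕ) : ℚ)) = ∏ i, ((p i : ℕ) : ℚ) by push_cast; rfl]
      rw [← Finset.prod_image (f := fun q : ℕ => (q : ℚ)) fun i _ j _ h => hinj h]
      rw [padicValRat_prod_primes (fun q hq => by
        obtain ⟨j, -, rfl⟩ := Finset.mem_image.mp hq; exact hp j)]
      rw [if_neg]
      intro h2
      obtain ⟨j, -, hj⟩ := Finset.mem_image.mp h2
      exact hp2 j hj
    rw [this]; rfl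
  have v22 : parityBit 2 (2 : ℚ) = 1 := by
    unfold parityBit
    rw [show padicValRat 2 (2 : ℚ) = 1 by simpa using padicValRat.self (p := 2) one_lt_two]; rfl
  -- a representative `a` of the first component
  obtain ⟨a, ha⟩ : ∃ a : ℚˣ, kummerEquiv ℚ 2 ((congruentNumberCurve (∏ i, p i)).twoTorsionCharH1 hT c) =
      Additive.ofMul (QuotientGroup.mk a) := by
    obtain ⟨a, ha⟩ := QuotientGroup.mk_surjective
      (Additive.toMul (kummerEquiv ℚ 2 ((congruentNumberCurve (∏ i, p i)).twoTorsionCharH1 hT c)))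
    exact ⟨a, by rw [ha]; rfl⟩
  -- the torsion pairs `(aₜ, bₜ)`: classes in `Sel⁽²⁾` with the four values of `ν`
  have key : ∀ (aT bT : ℚˣ), (congruentNumberCurve (∏ i, p i)).twoDescentClass hT aT bT ∈
        (congruentNumberCurve (∏ i, p i)).selmerGroup 2 →
      parityBit 2 (aT : ℚ) = parityBit 2 (a : ℚ) → signBit (bT : ℚ) = signBit (b : ℚ) →
      (sqClass (bT : ℚ) = 1 ∨ sqClass (bT : ℚ) = sqClass (-1 : ℚ) ∨ sqClass (bT : ℚ) = sqClass (N) ∨ sqClass (bT : ℚ) = sqClass (-N)) →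
      (sqClass (b : ℚ) = 1 ∨ sqClass (b : ℚ) = sqClass (-1 : ℚ) ∨ sqClass (b : ℚ) = sqClass (N) ∨ sqClass (b : ℚ) = sqClass (-N)) := by
    intro aT bT hmem hpa hsg hbt
    have hc' : c - (congruentNumberCurve (∏ i, p i)).twoDescentClass hT aT bT ∈
        (congruentNumberCurve (∏ i, p i)).selmerGroup 2 :=
      ((congruentNumberCurve (∏ i, p i)).selmerGroup 2).sub_mem hc hmem
    have ha' : kummerEquiv ℚ 2 ((congruentNumberCurve (∏ i, p i)).twoTorsionCharH1 hT
        (c - (congruentNumberCurve (∏ i, p i)).twoDescentClass hT aT bT)) =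
        Additive.ofMul (QuotientGroup.mk (a * aT)) := by
      rw [map_sub, map_sub, ha, (congruentNumberCurve (∏ i, p i)).kummerEquiv_twoTorsionCharH1_twoDescentClass hT aT bT,
        ← ofMul_div, QuotientGroup.mk_mul, div_eq_mul_inv, sqUnits_inv_eq_self]
    have hb' : kummerEquiv ℚ 2 ((congruentNumberCurve (∏ i, p i)).twoTorsionCharH1 hT.swap₁₂
        (c - (congruentNumberCurve (∏ i, p i)).twoDescentClass hT aT bT)) =
        Additive.ofMul (QuotientGroup.mk (b * bT)) := by
      rw [map_sub, map_sub, hb, (congruentNumberCurve (∏ i, p i)).kummerEquiv_twoTorsionCharH1_swap_twoDescentClass hT aT bT,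
        ← ofMul_div, QuotientGroup.mk_mul, div_eq_mul_inv, sqUnits_inv_eq_self]
    have ha2 : parityBit 2 ((a * aT : ℚˣ) : ℚ) = 0 := by
      rw [Units.val_mul, parityBit_mul a.ne_zero aT.ne_zero, hpa, ← two_mul, two_eq_zero_zmod2, zero_mul]
    have hsb : signBit ((b * bT : ℚˣ) : ℚ) = 0 := by
      rw [Units.val_mul, signBit_mul b.ne_zero bT.ne_zero, hsg, ← two_mul, two_eq_zero_zmod2, zero_mul]
    have hnorm := sqClass_eq_of_normalised hT hp hp2 hinj hker hc' (a * aT) (b * bT) ha' hb' ha2 hsb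
    rw [Units.val_mul, sqClass_mul b.ne_zero bT.ne_zero] at hnorm
    -- `[b] = [b bₜ] · [bₜ]`
    have hbb : sqClass (b : ℚ) = (sqClass (b : ℚ) * sqClass (bT : ℚ)) * sqClass (bT : ℚ) := by
      rw [mul_assoc, SqUnits.mul_self, mul_one]
    rw [hbb]
    exact inTorsionClasses_mul hN0 hnorm hbt
  -- case analysis on `ν(c) = (v₂(a), sign b)`
  rcases zmod2_cases (parityBit 2 (a : ℚ)) with h2a | h2a <;>
    rcases zmod2_cases (signBit (b : ℚ)) with hsb | hsb
  · -- `(0, 0)`: the class is already normalised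
    have hnorm := sqClass_eq_of_normalised hT hp hp2 hinj hker hc a b ha hb h2a hsb
    have := inTorsionClasses_mul hN0 hnorm (v := 1) (Or.inl rfl)
    rwa [mul_one] at this
  · -- `(0, 1)`: `T₂ = (0, 0)`, pair `(n, −n²)`
    have hb0 : ((0 : ℚ) - -N) * (0 - N) ≠ 0 := by
      rw [show ((0 : ℚ) - -N) * (0 - N) = -(N * N) by ring]; exact neg_ne_zero.mpr (mul_ne_zero hN0 hN0)
    refine key (Units.mk0 ((0 : ℚ) - -N) (by rw [sub_neg_eq_add, zero_add]; exact hN0)) (Units.mk0 _ hb0)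
      (twoDescentClass_mem_selmerGroup_T₂ (congruentNumberCurve (∏ i, p i)) hT _ _ rfl rfl) ?_ ?_ ?_
    · rw [Units.val_mk0, show (0 : ℚ) - -N = N by ring, v2N, h2a]
    · have hneg : ((0 : ℚ) - -N) * (0 - N) < 0 := by nlinarith
      rw [Units.val_mk0, hsb]
      exact signBit_of_neg hneg
    · right; left
      rw [Units.val_mk0, show ((0 : ℚ) - -N) * (0 - N) = (-1) * (N * N) by ring,
        sqClass_mul (by norm_num) (mul_ne_zero hN0 hN0), sqClass_mul_self, mul_one]
  · -- `(1, 0)`: `T₃ = (n, 0)`, pair `(2n, n)`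
    refine key (Units.mk0 (N - -N) (by rw [show N - -N = 2 * N by ring]; exact mul_ne_zero two_ne_zero hN0))
      (Units.mk0 (N - 0) (by rw [sub_zero]; exact hN0))
      (twoDescentClass_mem_selmerGroup_T₃ (congruentNumberCurve (∏ i, p i)) hT _ _ rfl rfl) ?_ ?_ ?_
    · rw [Units.val_mk0, show N - -N = 2 * N by ring, parityBit_mul two_ne_zero hN0, v22, v2N, add_zero, h2a]
    · rw [Units.val_mk0, sub_zero, (signBit_eq_zero_iff hN0).mpr hNpos, hsb]
    · right; right; left; rw [Units.val_mk0, sub_zero]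
  · -- `(1, 1)`: `T₁ = (−n, 0)`, pair `(2n², −n)`
    refine key (Units.mk0 ((-N - 0) * (-N - N)) (by
        rw [show (-N - 0) * (-N - N) = 2 * (N * N) by ring]; exact mul_ne_zero two_ne_zero (mul_ne_zero hN0 hN0)))
      (Units.mk0 (-N - 0) (by rw [sub_zero]; exact neg_ne_zero.mpr hN0))
      (twoDescentClass_mem_selmerGroup_T₁ (congruentNumberCurve (∏ i, p i)) hT _ _ rfl rfl) ?_ ?_ ?_
    · rw [Units.val_mk0, show (-N - 0) * (-N - N) = 2 * (N * N) by ring,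
        parityBit_mul two_ne_zero (mul_ne_zero hN0 hN0), parityBit_mul hN0 hN0, v22, v2N, add_zero, add_zero, h2a]
    · rw [Units.val_mk0, sub_zero, hsb]; exact signBit_of_neg (neg_neg_of_pos hNpos)
    · right; right; right; rw [Units.val_mk0, sub_zero]

end Selmer

/-- **`ρ(n) = 0` read off Monsky's kernel (odd `n`).** Let `n = p₁⋯p_k` with distinct odd primes and let
`M = ( A + D₂  D₂ ; D₂  A + D₋₂ )` be Monsky's matrix (`#Sel⁽²⁾(E_n/ℚ) = 2^{2+s(n)}`, `2^{s(n)} = #ker M`). If every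
kernel vector `(x; y)` of `M` has `x + y = 0` or `x + y = 𝟙` — for `s(n) = 1` this says the non-zero kernel vector
`v` has `b(v) = ∏ pᵢ^{xᵢ+yᵢ} ∈ {1, n}` — then `[E_n(ℚ) : φ_n(A_n(ℚ)) + E_n[2]] = 1`, i.e. Tian–Yuan–Zhang's
`ρ(n) = 0`. No hypothesis on the rank of `E_n(ℚ)` and none on `n (mod 8)`.
[cite: TianYuanZhang2017, §1, definition of ρ(n) (arXiv:1411.4728 chunk p0002 L101–L110)]
[cite: HeathBrown1994SelmerCongruentII, Appendix (Monsky), typescript p. 38 L17 – p. 39 L33]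
[cite: SilvermanAEC2009, Prop. X.1.4, Prop. X.4.9] -/
theorem rhoIndex_eq_one_of_monskyKernel_odd (hp : ∀ i, (p i).Prime) (hp2 : ∀ i, p i ≠ 2)
    (hinj : Function.Injective p)
    (hker : ∀ x y : Fin k → ZMod 2, monskyMatrixOdd p *ᵥ Sum.elim x y = 0 →
      x + y = 0 ∨ x + y = fun _ => 1)
    {n : ℕ} (hn : ∏ i, p i = n) : (rhoSubgroup n).index = 1 := by
  subst hn
  haveI := isElliptic_congruentNumberCurve (n_ne_zero hp)
  refine rhoIndex_eq_one_of_forall_inTorsionClasses (n_ne_zero hp) fun P => ?_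
  exact inTorsionClasses_descentRep_of_selmer (n_ne_zero hp)
    (fun c hc b hb => inTorsionClasses_of_mem_selmer (splitTwoTorsion_cn _) hp hp2 hinj hker hc b hb) P

/-- **`s(n) = 1` version.** If the kernel of Monsky's odd matrix is `{0, v}` and `x(v) + y(v) ∈ {0, 𝟙}`, then
`ρ(n) = 0`. [cite: TianYuanZhang2017, §1, definition of ρ(n)]
[cite: HeathBrown1994SelmerCongruentII, Appendix (Monsky), typescript p. 39] -/
theorem rhoIndex_eq_one_of_ker_pair_odd (hp : ∀ i, (p i).Prime) (hp2 : ∀ i, p i ≠ 2)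
    (hinj : Function.Injective p) (v : Fin k ⊕ Fin k → ZMod 2)
    (hker : ∀ w, monskyMatrixOdd p *ᵥ w = 0 → w = 0 ∨ w = v)
    (hv : (∀ i, v (Sum.inl i) + v (Sum.inr i) = 0) ∨ ∀ i, v (Sum.inl i) + v (Sum.inr i) = 1)
    {n : ℕ} (hn : ∏ i, p i = n) : (rhoSubgroup n).index = 1 := by
  refine rhoIndex_eq_one_of_monskyKernel_odd hp hp2 hinj (fun x y hxy => ?_) hn
  rcases hker _ hxy with h | h
  · left; funext i
    have h1 := congrFun h (Sum.inl i); have h2 := congrFun h (Sum.inr i)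
    simp only [Sum.elim_inl, Sum.elim_inr, Pi.zero_apply] at h1 h2
    simp [h1, h2]
  · have h1 : ∀ i, x i = v (Sum.inl i) := fun i => by simpa using congrFun h (Sum.inl i)
    have h2 : ∀ i, y i = v (Sum.inr i) := fun i => by simpa using congrFun h (Sum.inr i)
    rcases hv with hv | hv
    · left; funext i; rw [Pi.add_apply, h1, h2, hv i, Pi.zero_apply]
    · right; funext i; rw [Pi.add_apply, h1, h2, hv i]

/-- **Every prime, certificate-free**: `ρ(q) = 0` for EVERY odd prime `q` — for `q ≡ 3, 5 (mod 8)` as well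
(the Faulkner–James door `rhoIndex_eq_one_of_prime` needs `q ≡ ±1 (mod 8)`): the kernel of Monsky's `2 × 2`
matrix `( [2]_q  [2]_q ; [2]_q  [−2]_q )` is `{0, (1; 0)}` (`q ≡ ±1`) or `{0, (1; 1)}` (`q ≡ ±3`) or everything
with `x + y` constant. [cite: TianYuanZhang2017, §1, definition of ρ(n)]
[cite: HeathBrown1994SelmerCongruentII, Appendix (Monsky), typescript p. 39] -/
theorem rhoIndex_eq_one_of_odd_prime {q : ℕ} (hq : q.Prime) (hq2 : q ≠ 2) : (rhoSubgroup q).index = 1 := by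
  have hprod : (∏ i, (![q] : Fin 1 → ℕ) i) = q := by simp
  refine rhoIndex_eq_one_of_monskyKernel_odd (p := ![q]) (fun i => by fin_cases i; exact hq)
    (fun i => by fin_cases i; exact hq2) (fun i j _ => Subsingleton.elim i j) (fun x y _ => ?_) hprod
  rcases zmod2_cases (x 0 + y 0) with h | h
  · left; funext i; fin_cases i; simpa using h
  · right; funext i; fin_cases i; simpa using h

end Odd

end RhoMonskyKernel

end Literature.NumberTheory.EllipticCurves.TianYuanZhang2017

end
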